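import Mathlib
import Summits.ABC.ABC.Statement
import Summits.ABC.ABC.Theorems.SoloInformedBakerXi
import Summits.ABC.ABC.Theorems.SoloInformedWieferich

/-!
# Shadows of the lower doors on the Mersenne family (solo-ABC-informed, session 17)

The seat's door ladder (`run/shared/lean/ideation/ABC/solo-informed/paper/paper.md` §2.0) attaches a
linear-forms statement in print to each rung: Baker's `Ξ`-estimate at `abc` (equivalent to it,
`SoloInformedBakerXi.lean`), Philippon's PL at polynomial abc (a consequence of abc since session 17,
`SoloInformedPLRung.lean`), Baker's *weak* `Ξ`-estimate at quasi-polynomial abc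
(`SoloInformedQuasiPolyABC.lean`) and the one-place door `H(σ)` at subexponential abc
(`SoloInformedDoorB.lean`).  This file records, as plain inequalities, what the two LOWER doors demand
on the thinnest family `(1, 2^n - 1, 2^n)` and what abc itself allows there, so that the report's
sentence "the lower doors are sufficient, not necessary, on their face" has certified content:

* `soloInformed_mersenneExcess_le_of_weakXi`: Baker's weak `Ξ`-estimate (typed exactly as in
  `SoloInformedQuasiPolyABC.lean`) forces the powerful excess `(2^n - 1)/rad(2^n - 1)` to be at most
  `max(n,3)^{K log 2}` — POLYNOMIAL in `n`;
* `soloInformed_mersenneExcess_le_of_abc`: abc allows `K_ε · 2^{ε n}` — EXPONENTIAL in `n` — and no more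
  is extracted from it by this argument;
* `soloInformed_wieferichDepth_lt_of_padicSigma`: the one-place door `H(σ)` (typed exactly as in
  `SoloInformedDoorB.lean`, i.e. Pasten's `p`-adic clause with `p/log p ↦ p^σ`) forces the Wieferich depth
  `w_q = v_q(2^{q-1} - 1)` of every prime `q` to satisfy `w_q · log q < K q^σ · log(max(e, q(q-1) log 2)) · log 2`;
* `soloInformed_pow_wieferichDepth_le_of_abc`: abc allows `q^{w_q - 1} ≤ K_ε · 2^{ε (q-1)}`, i.e.
  `w_q ≤ 1 + ε (q-1) log 2/log q + log K_ε/log q` — against the trivial `w_q < q`.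

By lifting the exponent (`soloInformed_padicValNat_two_pow_sub_one` of `SoloInformedWieferich.lean`:
`v_q(2^p - 1) = w_q` for `q ∣ 2^p - 1`, `p` prime) every one-prime statement on this family is a statement
about Wieferich depths; the lower doors ask polynomial (`n^{K}`, `q^σ`) scarcity where abc asks only
exponential-with-small-rate (`2^{εn}`, `ε q/log q`).  Nothing here claims that abc does not imply the
lower doors — only that the implication, if true, is an unproved statement about Wieferich primes
(the record consequence of abc in this direction is Silverman's: infinitely many `q` with `w_q = 1`,
`soloInformed_infinite_not_isWieferich_of_abc`).  Mathlib + `Statement` + the two session files only;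
no new `Prop` constants. [folklore]
-/

noncomputable section

open Real Height UniqueFactorizationMonoid
open Literature.NumberTheory.DiophantineGeometry

namespace Summit.ABC.ABC.Theorems

/-- Baker's `Ξ` for the linear form `log(c/a)` of the triple `a + b = c`, written out as in
`SoloInformedBakerXi.lean` / `SoloInformedQuasiPolyABC.lean` (no constant is introduced).
[cite: Baker2004, §2 (p. 256)] -/
local notation "ΞB(" a ", " b ", " c ")" =>
  (min 1 (Real.log ((c : ℝ) / (a : ℝ))) *
    ∏ p ∈ Nat.primeFactors b, min 1 ((p : ℝ) / (p : ℝ) ^ Nat.factorization b p))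

/-! ### An elementary divisibility: `q^{v_q(b) - 1} · rad(b) ∣ b` -/

/-- For every prime `q` and every `b`, `q^{v_q(b)-1} · rad(b)` divides `b`: the powerful excess
`b / rad(b)` is divisible by `q^{v_q(b)-1}`. [folklore] -/
theorem soloInformed_pow_pred_mul_radical_dvd {q : ℕ} (hq : q.Prime) (b : ℕ) :
    q ^ (padicValNat q b - 1) * radical b ∣ b := by
  rcases Nat.eq_zero_or_pos (padicValNat q b) with hv | hv
  · rw [hv]; simpa using (radical_dvd_self : radical b ∣ b)
  · obtain ⟨m, hm⟩ := (pow_padicValNat_dvd : q ^ padicValNat q b ∣ b)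
    have hradq : radical (q ^ padicValNat q b) = q := by
      rw [radical_pow_of_prime (Nat.prime_iff.mp hq) hv.ne']; simp
    have h1 : radical b ∣ q * radical m := by
      conv_lhs => rw [hm]
      have := (radical_mul_dvd : radical (q ^ padicValNat q b * m) ∣ _)
      rwa [hradq] at this
    have h2 : q ^ (padicValNat q b - 1) * radical b ∣ q ^ (padicValNat q b - 1) * (q * radical m) :=
      mul_dvd_mul_left _ h1
    refine h2.trans ?_
    rw [← mul_assoc, ← pow_succ, Nat.sub_add_cancel hv]
    conv_rhs => rw [hm]
    exact mul_dvd_mul_left _ radical_dvd_self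

/-! ### Baker's weak `Ξ`-estimate on the Mersenne family -/

/-- **Weak `Ξ` ⟹ polynomial powerful excess of Mersenne numbers.**  Baker's weak `Ξ`-estimate for
`Λ = log(c/a)` (hypothesis typed exactly as in `soloInformed_quasiPolyABC_of_weakXi`), applied to the
triple `(1, 2^n - 1, 2^n)` with the admissible `u = n` (`rad(ca) = 2`), gives
`(2^n - 1)/rad(2^n - 1) ≤ max(n,3)^{K log 2}`. [folklore] -/
theorem soloInformed_mersenneExcess_le_of_weakXi {K : ℝ}
    (hXi : ∀ a b c : ℕ, IsABCTriple a b c → ∀ u : ℕ, (∀ p : ℕ, (c * a).factorization p ≤ u) →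
      -(K * Real.log ((radical (c * a) : ℕ) : ℝ) * Real.log ((max u 3 : ℕ) : ℝ)) ≤
        Real.log (ΞB(a, b, c)))
    {n : ℕ} (hn : 0 < n) :
    ((2 ^ n - 1 : ℕ) : ℝ) / ((radical (2 ^ n - 1) : ℕ) : ℝ) ≤
      ((max n 3 : ℕ) : ℝ) ^ (K * Real.log 2) := by
  have ht : IsABCTriple 1 (2 ^ n - 1) (2 ^ n) := soloInformed_isABCTriple_mersenne hn
  have hb0 : 0 < 2 ^ n - 1 := ht.2.1
  have hfac : ∀ p : ℕ, (2 ^ n * 1).factorization p ≤ n := by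
    intro p
    rw [mul_one, Nat.Prime.factorization_pow Nat.prime_two, Finsupp.single_apply]
    split_ifs <;> omega
  have hrad : (radical (2 ^ n * 1) : ℕ) = 2 := by
    rw [mul_one, radical_pow_of_prime Nat.prime_two.prime hn.ne']; simp
  have h1 := hXi 1 (2 ^ n - 1) (2 ^ n) ht n hfac
  rw [hrad] at h1
  have hΞle := soloInformed_bakerXi_le ht
  have hΞpos := soloInformed_bakerXi_pos ht
  have hb1 : (1 : ℝ) ≤ ((2 ^ n - 1 : ℕ) : ℝ) := by exact_mod_cast hb0
  have hbR : (0 : ℝ) < ((2 ^ n - 1 : ℕ) : ℝ) := by exact_mod_cast hb0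
  have hrR : (0 : ℝ) < ((radical (2 ^ n - 1) : ℕ) : ℝ) := by exact_mod_cast Nat.radical_pos _
  have hm3 : (3 : ℝ) ≤ ((max n 3 : ℕ) : ℝ) := by exact_mod_cast le_max_right n 3
  have hm0 : (0 : ℝ) < ((max n 3 : ℕ) : ℝ) := by linarith
  -- `max 1 b = b`, and make the three hypotheses mention `Ξ` in the same syntactic form
  rw [Nat.cast_one, max_eq_right hb1] at hΞle
  rw [Nat.cast_one] at hΞpos h1
  -- log Ξ ≤ log (rad b / b) = log rad b - log b
  have hlog := Real.log_le_log hΞpos hΞle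
  rw [Real.log_div hrR.ne' hbR.ne'] at hlog
  have h2 : Real.log ((2 : ℕ) : ℝ) = Real.log 2 := by norm_num
  rw [h2] at h1
  have hkey : Real.log (((2 ^ n - 1 : ℕ) : ℝ) / ((radical (2 ^ n - 1) : ℕ) : ℝ)) ≤
      K * Real.log 2 * Real.log ((max n 3 : ℕ) : ℝ) := by
    rw [Real.log_div hbR.ne' hrR.ne']
    linarith
  calc ((2 ^ n - 1 : ℕ) : ℝ) / ((radical (2 ^ n - 1) : ℕ) : ℝ)
      = Real.exp (Real.log (((2 ^ n - 1 : ℕ) : ℝ) / ((radical (2 ^ n - 1) : ℕ) : ℝ))) := by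
        rw [Real.exp_log (by positivity)]
    _ ≤ Real.exp (K * Real.log 2 * Real.log ((max n 3 : ℕ) : ℝ)) := Real.exp_le_exp.mpr hkey
    _ = ((max n 3 : ℕ) : ℝ) ^ (K * Real.log 2) := by
        rw [Real.rpow_def_of_pos hm0]; ring_nf

/-! ### What abc allows on the same family -/

/-- **abc ⟹ exponential allowance for the powerful excess of Mersenne numbers.**  From the triple
`(1, 2^n - 1, 2^n)`: `(2^n - 1)/rad(2^n - 1) ≤ K_ε · 2^{ε n}` for every `ε > 0`.  (abc at exponent
`1 + ε` gives `2^n < C (2 rad(2^n-1))^{1+ε}`, and `rad(2^n - 1)^ε ≤ 2^{εn}`.) [folklore] -/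
theorem soloInformed_mersenneExcess_le_of_abc (h : _root_.ABC) {ε : ℝ} (hε : 0 < ε) :
    ∃ K : ℝ, 1 ≤ K ∧ ∀ n : ℕ, 0 < n →
      ((2 ^ n - 1 : ℕ) : ℝ) / ((radical (2 ^ n - 1) : ℕ) : ℝ) ≤ K * (2 : ℝ) ^ (ε * n) := by
  obtain ⟨C, hC0, hC⟩ := h ε hε
  refine ⟨max 1 (C * (2 : ℝ) ^ (1 + ε)), le_max_left _ _, fun n hn => ?_⟩
  have ht : IsABCTriple 1 (2 ^ n - 1) (2 ^ n) := soloInformed_isABCTriple_mersenne hn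
  have hb0 : 0 < 2 ^ n - 1 := ht.2.1
  set b : ℕ := 2 ^ n - 1 with hb_def
  have hbR : (0 : ℝ) < (b : ℝ) := by exact_mod_cast hb0
  have hrR : (0 : ℝ) < ((radical b : ℕ) : ℝ) := by exact_mod_cast Nat.radical_pos _
  have hradle : ((radical b : ℕ) : ℝ) ≤ (2 : ℝ) ^ (n : ℝ) := by
    have h1 : radical b ≤ b := Nat.le_of_dvd hb0 radical_dvd_self
    have h2 : (b : ℝ) ≤ (2 : ℝ) ^ (n : ℝ) := by
      rw [Real.rpow_natCast, hb_def]; push_cast [Nat.one_le_two_pow]; linarith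
    exact le_trans (by exact_mod_cast h1) h2
  -- abc: c < C * rad(abc)^{1+ε}, rad(abc) ≤ 2 rad b
  have habc := hC 1 b (2 ^ n) ht
  have hradM : ((rad 1 b (2 ^ n) : ℕ) : ℝ) ≤ 2 * ((radical b : ℕ) : ℝ) := by
    exact_mod_cast soloInformed_rad_mersenne_le hn
  have hRpos : (0 : ℝ) < ((rad 1 b (2 ^ n) : ℕ) : ℝ) := by
    rw [rad_def]; exact_mod_cast Nat.radical_pos _
  have hε1 : (0 : ℝ) < 1 + ε := by linarith
  have hpow : ((rad 1 b (2 ^ n) : ℕ) : ℝ) ^ (1 + ε) ≤ (2 * ((radical b : ℕ) : ℝ)) ^ (1 + ε) :=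
    Real.rpow_le_rpow hRpos.le hradM hε1.le
  have hc : ((2 ^ n : ℕ) : ℝ) < C * (2 * ((radical b : ℕ) : ℝ)) ^ (1 + ε) :=
    lt_of_lt_of_le habc (mul_le_mul_of_nonneg_left hpow hC0.le)
  -- (2 r)^{1+ε} = 2^{1+ε} * r * r^ε ≤ 2^{1+ε} * r * 2^{ε n}
  have hsplit : (2 * ((radical b : ℕ) : ℝ)) ^ (1 + ε) =
      (2 : ℝ) ^ (1 + ε) * (((radical b : ℕ) : ℝ) * ((radical b : ℕ) : ℝ) ^ ε) := by
    rw [Real.mul_rpow (by norm_num) hrR.le, Real.rpow_add hrR, Real.rpow_one]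
  have hrε : ((radical b : ℕ) : ℝ) ^ ε ≤ (2 : ℝ) ^ (ε * n) := by
    calc ((radical b : ℕ) : ℝ) ^ ε ≤ ((2 : ℝ) ^ (n : ℝ)) ^ ε :=
          Real.rpow_le_rpow hrR.le hradle hε.le
      _ = (2 : ℝ) ^ (ε * n) := by rw [← Real.rpow_mul (by norm_num), mul_comm]
  have hbc : (b : ℝ) ≤ ((2 ^ n : ℕ) : ℝ) := by
    rw [hb_def]; exact_mod_cast Nat.sub_le _ _
  have h2ε : (0 : ℝ) < (2 : ℝ) ^ (1 + ε) := by positivity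
  have hmain : (b : ℝ) / ((radical b : ℕ) : ℝ) ≤ C * (2 : ℝ) ^ (1 + ε) * (2 : ℝ) ^ (ε * n) := by
    rw [div_le_iff₀ hrR]
    have : (b : ℝ) < C * ((2 : ℝ) ^ (1 + ε) * (((radical b : ℕ) : ℝ) * ((radical b : ℕ) : ℝ) ^ ε)) := by
      rw [← hsplit]; exact lt_of_le_of_lt hbc hc
    have h3 : C * ((2 : ℝ) ^ (1 + ε) * (((radical b : ℕ) : ℝ) * ((radical b : ℕ) : ℝ) ^ ε)) ≤
        C * (2 : ℝ) ^ (1 + ε) * (2 : ℝ) ^ (ε * n) * ((radical b : ℕ) : ℝ) := by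
      have := mul_le_mul_of_nonneg_left hrε (by positivity : (0 : ℝ) ≤ C * (2 : ℝ) ^ (1 + ε) * ((radical b : ℕ) : ℝ))
      calc C * ((2 : ℝ) ^ (1 + ε) * (((radical b : ℕ) : ℝ) * ((radical b : ℕ) : ℝ) ^ ε))
          = C * (2 : ℝ) ^ (1 + ε) * ((radical b : ℕ) : ℝ) * ((radical b : ℕ) : ℝ) ^ ε := by ring
        _ ≤ C * (2 : ℝ) ^ (1 + ε) * ((radical b : ℕ) : ℝ) * (2 : ℝ) ^ (ε * n) := this
        _ = C * (2 : ℝ) ^ (1 + ε) * (2 : ℝ) ^ (ε * n) * ((radical b : ℕ) : ℝ) := by ring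
    linarith
  calc (b : ℝ) / ((radical b : ℕ) : ℝ) ≤ C * (2 : ℝ) ^ (1 + ε) * (2 : ℝ) ^ (ε * n) := hmain
    _ ≤ max 1 (C * (2 : ℝ) ^ (1 + ε)) * (2 : ℝ) ^ (ε * n) :=
        mul_le_mul_of_nonneg_right (le_max_right _ _) (by positivity)

/-- **abc ⟹ a bound on Wieferich depths, exponential rate `ε`.**  With `w_q = v_q(2^{q-1} - 1)`:
`q^{w_q - 1} ≤ K_ε · 2^{ε (q - 1)}` for every prime `q` and every `ε > 0` (from the previous theorem at
`n = q - 1` and `q^{w_q - 1} · rad ∣ 2^{q-1} - 1`).  Unconditionally only `w_q < q` is known in general;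
abc makes it `w_q ≤ 1 + (ε (q-1) log 2 + log K_ε)/log q`. [folklore] -/
theorem soloInformed_pow_wieferichDepth_le_of_abc (h : _root_.ABC) {ε : ℝ} (hε : 0 < ε) :
    ∃ K : ℝ, 1 ≤ K ∧ ∀ q : ℕ, q.Prime →
      (q : ℝ) ^ (padicValNat q (2 ^ (q - 1) - 1) - 1) ≤ K * (2 : ℝ) ^ (ε * (q - 1 : ℕ)) := by
  obtain ⟨K, hK1, hK⟩ := soloInformed_mersenneExcess_le_of_abc h hε
  refine ⟨K, hK1, fun q hq => ?_⟩
  have hq1 : 0 < q - 1 := by have := hq.two_le; omega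
  have hb0 : 0 < 2 ^ (q - 1) - 1 := (soloInformed_isABCTriple_mersenne hq1).2.1
  have hdvd := soloInformed_pow_pred_mul_radical_dvd hq (2 ^ (q - 1) - 1)
  have hle : q ^ (padicValNat q (2 ^ (q - 1) - 1) - 1) * radical (2 ^ (q - 1) - 1) ≤ 2 ^ (q - 1) - 1 :=
    Nat.le_of_dvd hb0 hdvd
  have hrR : (0 : ℝ) < ((radical (2 ^ (q - 1) - 1) : ℕ) : ℝ) := by exact_mod_cast Nat.radical_pos _
  have h1 : (q : ℝ) ^ (padicValNat q (2 ^ (q - 1) - 1) - 1) ≤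
      ((2 ^ (q - 1) - 1 : ℕ) : ℝ) / ((radical (2 ^ (q - 1) - 1) : ℕ) : ℝ) := by
    rw [le_div_iff₀ hrR]; exact_mod_cast hle
  exact h1.trans (hK (q - 1) hq1)

/-! ### The one-place door `H(σ)` on the Mersenne family -/

/-- **`H(σ)` ⟹ Wieferich depths `≪ q^σ`.**  The one-place door of `SoloInformedDoorB.lean` (Pasten's
`p`-adic clause over `ℚ` with the factor `p/log p` replaced by `p^σ`; hypothesis typed exactly as there),
applied to the single generator `ξ = 2` with exponent `q - 1` at the prime `q`, gives
`w_q · log q < K · q^σ · log(max(e, q (q-1) log 2)) · log 2`. [folklore] -/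
theorem soloInformed_wieferichDepth_lt_of_padicSigma {σ K : ℝ}
    (hP : ∀ (ι : Type) [Fintype ι], 0 < Fintype.card ι → ∀ ξ : ι → ℚ,
      (∀ i, ξ i ≠ 0 ∧ ξ i ≠ 1 ∧ ξ i ≠ -1) → ∀ ζ : ℚ, (ζ = 1 ∨ ζ = -1) → ∀ b : ι → ℤ,
      ζ * ∏ i, ξ i ^ b i ≠ 1 → ∀ p : ℕ, p.Prime →
      (padicValRat p (1 - ζ * ∏ i, ξ i ^ b i) : ℝ) * Real.log p <
        K ^ Fintype.card ι * (p : ℝ) ^ σ *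
          Real.log (max (Real.exp 1) (p * logHeight₁ (ζ * ∏ i, ξ i ^ b i))) *
            ∏ i, logHeight₁ (ξ i))
    {q : ℕ} (hq : q.Prime) :
    (padicValNat q (2 ^ (q - 1) - 1) : ℝ) * Real.log q <
      K * (q : ℝ) ^ σ * Real.log (max (Real.exp 1) (q * (((q - 1 : ℕ) : ℝ) * Real.log 2))) *
        Real.log 2 := by
  have hq1 : 0 < q - 1 := by have := hq.two_le; omega
  have h := hP Unit (by simp) (fun _ => (2 : ℚ))
    (fun _ => ⟨by norm_num, by norm_num, by norm_num⟩) 1 (Or.inl rfl) (fun _ => ((q - 1 : ℕ) : ℤ))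
  have hprod : (1 : ℚ) * ∏ _i : Unit, (2 : ℚ) ^ ((q - 1 : ℕ) : ℤ) = ((2 ^ (q - 1) : ℕ) : ℚ) := by
    simp [zpow_natCast]
  rw [hprod] at h
  have hne : ((2 ^ (q - 1) : ℕ) : ℚ) ≠ 1 := by
    have : 1 < 2 ^ (q - 1) := Nat.one_lt_two_pow hq1.ne'
    exact_mod_cast this.ne'
  have h2 := h hne q hq
  -- rewrite the valuation and the heights
  have hval : padicValRat q (1 - ((2 ^ (q - 1) : ℕ) : ℚ)) = padicValNat q (2 ^ (q - 1) - 1) := by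
    have hsub : (1 : ℚ) - ((2 ^ (q - 1) : ℕ) : ℚ) = -(((2 ^ (q - 1) - 1 : ℕ) : ℚ)) := by
      push_cast [Nat.one_le_two_pow]; ring
    rw [hsub, padicValRat.neg, padicValRat.of_nat]
  have hH2 : logHeight₁ (2 : ℚ) = Real.log 2 := by
    have := Rat.logHeight₁_natCast 2
    push_cast at this
    exact this
  haveI : NeZero (2 ^ (q - 1) : ℕ) := ⟨by positivity⟩
  have hHpow : logHeight₁ (((2 ^ (q - 1) : ℕ)) : ℚ) = ((q - 1 : ℕ) : ℝ) * Real.log 2 := by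
    rw [Rat.logHeight₁_natCast]; push_cast; rw [Real.log_pow]
  simp only [Fintype.card_unit, pow_one, Finset.prod_const, Finset.card_univ, hval, hH2, hHpow]
    at h2
  exact_mod_cast h2

end Summit.ABC.ABC.Theorems

end
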